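import Summits.CriticalPhenomena.PercolationContinuityZ3.Theorems.PercNearOneGluingNoHeavyLowerTailThreePartitionGridMatching
import HarnessLib.Audit

/-!
# `NoHeavyLowerTail` (crux stmt-CriticalPhenomena-4575), master-family hierarchy P3 (gen 36): the TYPED matching for TWO DISJUNCTIONS —
# `TypedMatchable ∅ (OR P) (OR Q)` by an EXPLICIT matching with genuine DIVERSIONS (the first such class; it contains the 'triangle' pair)

Support file (seat `prim-masterthm-p3`; `--supports stmt-CriticalPhenomena-4575`; memo
`run/shared/lean/prim/prim-masterthm/FROM-prim-masterthm-p3-g36-CYLINDER-SLACK.md` §9; exact checker `code/e16_oror.py`: all 2 556 pairs on `n ≤ 6`).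
Companion of `…ThreePartitionGridMatching` (`negToks`, `posToks`, `typedEdge`, `TypedMatchable`).

SETTING (untwisted, `τ = ∅`).  `V = OR(P) = {S : S ∩ P ≠ ∅}`, `W = OR(Q)`, `T := P ∩ Q`, `P′ := P ∖ Q`; configurations `(x₁,x₂,x₃)`.  The classes already in the
kernel are `V = ⊤`, balanced and `V ⊆ W`; for `P ⊄ Q ⊄ P`, `T ≠ ∅` the pair `(OR P, OR Q)` is in none of them and its a-side is deficient (the seat's census:
`δ = 2` for the triangle `P = {0,1}, Q = {0,2}`), so bad tokens MUST be diverted to b-units.  THE MATCHING `ororMap` (memo §9):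
* `N1` at `x₁ ∈ A`: own unit a.  Bad `N1` (`x₁ ∩ Q = ∅`): CANONICAL LANDING on unit a of `(x₁ ∪ (x₃∩Q), x₂, x₃∖Q)` unless that site is RESERVED, i.e.
  `P′∩x₂ = ∅ ∧ P′∩x₁ ≠ ∅ ∧ (T ⊄ x₃ ∨ x₃∩Q = T)`; reserved landers DIVERT: to unit b of `(x₁ ∪ (x₂∩T), x₂∖T, x₃)` if `T ⊄ x₃`, of `(x₁ ∪ T, x₂, x₃∖T)` if `x₃ ∩ Q = T`.
* `N2` at `x₁ ∈ A`: own unit b; else unit b of `(x₁ ∪ (x₂∩P), x₂∖P, x₃)`.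
* `N3` with `x₃ ∈ W`: own `T₂`; else (`x₃ ∩ Q = ∅`, `L :⟺ x₂∩P′ ≠ ∅`): EXIT to the `T₂` token `(x₁, x₂∖Q, x₃ ∪ (x₂∩Q))` if `L ∧ (P′∩x₁ ≠ ∅ ∨ (T ⊆ x₂ ∧ x₂∩Q ≠ T))`
  (the mirror of a landed site exits to the mirror of its lander); SHIFT to unit a of `(x₁ ∪ T, x₂∖T, x₃)` if `T ⊆ x₂ ∧ ((¬L ∧ (P′∩x₁ = ∅ ∨ Q ⊆ x₂)) ∨
  (L ∧ P′∩x₁ = ∅ ∧ x₂∩Q = T))`; otherwise its own unit a.  (These are the Kleitman pairings `s ↔ σs` / `σs ∪ T` between the unlandable sites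
  `{s : s∩P′ = ∅, s∩T ≠ ∅}` of a fibre and the reserved landable ones, and the explicit pairing `x ↦ x ∪ T` of `OR(T)` on fibres without landable sites.)
Injectivity is by an explicit DECODER `ororInv` with `ororInv (ororMap t) = t` on negative tokens (companion file `…GridOrOrMatching`,
which assembles `typedMatchable_orOr`); this file: the two maps, the token/edge unfoldings at `τ = ∅`, and the FORWARD spec `ororMap_spec`.
HONEST LABEL: one new class of the OPEN conjecture `TypedGridMatching`, untwisted only (the construction moves named coordinates between copies, which is
illegal for twisted coordinates; the all-`τ` statement holds by census `n ≤ 5`, gen 34); COMB-C3 / Sahi's `C₃` OPEN; nothing bears on the (closed) crux. [this work]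
-/

noncomputable section

open Finset
open scoped symmDiff Classical

namespace Summit.CriticalPhenomena.PercolationContinuityZ3.Theorems.ThreePartition

variable {ι : Type*} [Fintype ι]

/-! ## The OR families and the untwisted copies -/

omit [Fintype ι] in
/-- The disjunction (co-principal up-set) `OR(P) = {S : S ∩ P ≠ ∅}`. [this work] -/
def orFam (P : Set ι) : Set (Set ι) := {S | (S ∩ P).Nonempty}

omit [Fintype ι] in
/-- Membership in `OR(P)`. [this work] -/
@[simp] theorem mem_orFam {P S : Set ι} : S ∈ orFam P ↔ (S ∩ P).Nonempty := Iff.rfl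

omit [Fintype ι] in
/-- `OR(P)` is an up-set. [this work] -/
theorem isUpperSet_orFam (P : Set ι) : IsUpperSet (orFam P) :=
  fun _ _ hle h => h.mono (Set.inter_subset_inter_left _ hle)

omit [Fintype ι] in
/-- Untwisted copy 1. [this work] -/
@[simp] theorem cp₁_empty (q : Set ι × Set ι) : cp₁ (∅ : Set ι) q = q.1 := symmDiff_bot q.1

omit [Fintype ι] in
/-- Untwisted copy 2. [this work] -/
@[simp] theorem cp₂_empty (q : Set ι × Set ι) : cp₂ (∅ : Set ι) q = q.2 := symmDiff_bot q.2

omit [Fintype ι] in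
/-- Untwisted copy 3. [this work] -/
@[simp] theorem cp₃_empty (q : Set ι × Set ι) : cp₃ (∅ : Set ι) q = (q.1 ∪ q.2)ᶜ := symmDiff_bot _

/-! ## The explicit matching -/

section Map

variable (P Q : Set ι)

omit [Fintype ι] in
/-- **The matching** (memo §9 case table; `T = P ∩ Q`, `P′ = P ∖ Q`, `x₃ = (x₁ ∪ x₂)ᶜ`). [this work] -/
def ororMap (t : (Set ι × Set ι) × Fin 3) : (Set ι × Set ι) × Fin 3 :=
  let x₁ := t.1.1
  let x₂ := t.1.2
  let x₃ := (t.1.1 ∪ t.1.2)ᶜ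
  let T := P ∩ Q
  let P' := P \ Q
  if t.2 = 0 then
    if (x₁ ∩ Q).Nonempty then t
    else if P' ∩ x₂ = ∅ ∧ (P' ∩ x₁).Nonempty ∧ ¬ T ⊆ x₃ then ((x₁ ∪ (x₂ ∩ T), x₂ \ T), 1)
    else if P' ∩ x₂ = ∅ ∧ (P' ∩ x₁).Nonempty ∧ x₃ ∩ Q = T then ((x₁ ∪ T, x₂), 1)
    else ((x₁ ∪ (x₃ ∩ Q), x₂), 0)
  else if t.2 = 1 then
    if (x₁ ∩ P).Nonempty then t else ((x₁ ∪ (x₂ ∩ P), x₂ \ P), 1)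
  else
    if (x₃ ∩ Q).Nonempty then t
    else if (x₂ ∩ P').Nonempty ∧ ((P' ∩ x₁).Nonempty ∨ (T ⊆ x₂ ∧ x₂ ∩ Q ≠ T)) then ((x₁, x₂ \ Q), 2)
    else if T ⊆ x₂ ∧ ((¬ (x₂ ∩ P').Nonempty ∧ (P' ∩ x₁ = ∅ ∨ Q ⊆ x₂)) ∨ ((x₂ ∩ P').Nonempty ∧ P' ∩ x₁ = ∅ ∧ x₂ ∩ Q = T))
      then ((x₁ ∪ T, x₂ \ T), 0)
    else (t.1, 0)

omit [Fintype ι] in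
/-- **The decoder** (left inverse of `ororMap` on the negative tokens). [this work] -/
def ororInv (p : (Set ι × Set ι) × Fin 3) : (Set ι × Set ι) × Fin 3 :=
  let y₁ := p.1.1
  let y₂ := p.1.2
  let y₃ := (p.1.1 ∪ p.1.2)ᶜ
  let T := P ∩ Q
  let P' := P \ Q
  if p.2 = 0 then
    if (y₃ ∩ Q).Nonempty then p
    else if (y₁ ∩ P').Nonempty ∧ ((y₂ ∩ P').Nonempty ∨ (T ⊆ y₁ ∧ y₁ ∩ Q ≠ T)) then ((y₁ \ Q, y₂), 0)
    else if (y₂ ∩ P).Nonempty ∧ (y₂ ∩ Q).Nonempty then (p.1, 2)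
    else ((y₁ \ T, y₂ ∪ T), 2)
  else if p.2 = 1 then
    if (y₂ ∩ P).Nonempty then p
    else if (y₁ ∩ (Q \ P)).Nonempty then ((y₁ \ P, y₂ ∪ (y₁ ∩ P)), 1)
    else if (y₃ ∩ Q).Nonempty then ((y₁ \ T, y₂ ∪ (y₁ ∩ T)), 0)
    else ((y₁ \ T, y₂), 0)
  else
    if (y₂ ∩ Q).Nonempty then p else ((y₁, y₂ ∪ (y₃ ∩ Q)), 2)

end Map

/-! ## Tokens, unfolded at `τ = ∅` -/

omit [Fintype ι] in
/-- The three elements of `Fin 3`. [folklore] -/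
private theorem fin3_cases (i : Fin 3) : i = 0 ∨ i = 1 ∨ i = 2 := by
  fin_cases i <;> simp

/-- Membership in the negative tokens, untwisted, for the OR pair. [this work] -/
theorem mem_negToks_orOr {P Q : Set ι} {t : (Set ι × Set ι) × Fin 3} :
    t ∈ negToks (∅ : Set ι) (orFam P) (orFam Q) ↔
      Disjoint t.1.1 t.1.2 ∧
        ((t.2 = 0 ∧ (t.1.1 ∩ P).Nonempty ∧ ((t.1.1 ∪ t.1.2)ᶜ ∩ Q).Nonempty) ∨
         (t.2 = 1 ∧ (t.1.1 ∩ Q).Nonempty ∧ (t.1.2 ∩ P).Nonempty) ∨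
         (t.2 = 2 ∧ (t.1.2 ∩ P).Nonempty ∧ (t.1.2 ∩ Q).Nonempty)) := by
  unfold negToks cfgs negCond
  simp only [mem_filter, mem_product, mem_univ, and_true, true_and, cp₁_empty, cp₂_empty, cp₃_empty, mem_orFam]
  rcases fin3_cases t.2 with h | h | h <;> simp [h]

/-- Membership in the positive tokens, untwisted, for the OR pair. [this work] -/
theorem mem_posToks_orOr {P Q : Set ι} {p : (Set ι × Set ι) × Fin 3} :
    p ∈ posToks (∅ : Set ι) (orFam P) (orFam Q) ↔
      Disjoint p.1.1 p.1.2 ∧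
        ((p.2 = 0 ∧ (p.1.1 ∩ P).Nonempty ∧ (p.1.1 ∩ Q).Nonempty) ∨
         (p.2 = 1 ∧ (p.1.1 ∩ P).Nonempty ∧ (p.1.1 ∩ Q).Nonempty) ∨
         (p.2 = 2 ∧ (p.1.2 ∩ P).Nonempty ∧ ((p.1.1 ∪ p.1.2)ᶜ ∩ Q).Nonempty)) := by
  unfold posToks cfgs posCond
  simp only [mem_filter, mem_product, mem_univ, and_true, true_and, cp₁_empty, cp₂_empty, cp₃_empty, mem_orFam]
  rcases fin3_cases p.2 with h | h | h <;> simp [h]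

omit [Fintype ι] in
/-- The typed edge relation, untwisted. [this work] -/
theorem typedEdge_empty {q q' : Set ι × Set ι} {i j : Fin 3} :
    typedEdge (∅ : Set ι) q i q' j ↔
      (q.1 ⊆ q'.1 ∧ q'.2 ⊆ q.2) ∧
        ((i = 0 ∧ ((j = 0 ∧ q'.2 = q.2) ∨ (j = 1 ∧ (q'.1 ∪ q'.2)ᶜ ⊆ (q.1 ∪ q.2)ᶜ))) ∨
         (i = 1 ∧ j = 1 ∧ (q'.1 ∪ q'.2)ᶜ = (q.1 ∪ q.2)ᶜ) ∨
         (i = 2 ∧ ((j = 0 ∧ (q'.1 ∪ q'.2)ᶜ = (q.1 ∪ q.2)ᶜ) ∨ (j = 2 ∧ q'.1 = q.1)))) := by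
  have e : ∀ s : Set ι, s ∆ (∅ : Set ι) = s := fun s => symmDiff_bot s
  unfold typedEdge gle
  simp only [cp₁_empty, cp₂_empty, cp₃_empty, e]

/-! ## Forward: the map sends negative tokens to positive tokens along typed edges -/

omit [Fintype ι] in
/-- `1 ≠ 0` in `Fin 3`. [folklore] -/
private theorem fin10 : ¬ ((1 : Fin 3) = 0) := by decide
omit [Fintype ι] in
/-- `2 ≠ 0` in `Fin 3`. [folklore] -/
private theorem fin20 : ¬ ((2 : Fin 3) = 0) := by decide
omit [Fintype ι] in
/-- `2 ≠ 1` in `Fin 3`. [folklore] -/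
private theorem fin21 : ¬ ((2 : Fin 3) = 1) := by decide

/-- **Forward spec**: every negative token is sent to a positive token along a typed edge. [this work] -/
theorem ororMap_spec (P Q : Set ι) {t : (Set ι × Set ι) × Fin 3} (ht : t ∈ negToks (∅ : Set ι) (orFam P) (orFam Q)) :
    ororMap P Q t ∈ posToks (∅ : Set ι) (orFam P) (orFam Q) ∧
      typedEdge (∅ : Set ι) t.1 t.2 (ororMap P Q t).1 (ororMap P Q t).2 := by
  obtain ⟨⟨x₁, x₂⟩, i⟩ := t
  rw [mem_negToks_orOr] at ht
  obtain ⟨hdis, hk⟩ := ht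
  dsimp only at hdis hk
  have hd : ∀ a, a ∈ x₁ → a ∈ x₂ → False := fun a ha hb => Set.disjoint_left.1 hdis ha hb
  rcases hk with ⟨rfl, hV, hW⟩ | ⟨rfl, hW1, hV2⟩ | ⟨rfl, hP2, hQ2⟩
  · -- N1 tokens: `x₁ ∈ V`, `x₃ ∈ W`
    simp only [ororMap, if_true]
    split_ifs with h1 h2 h3
    · -- at a P-configuration: own unit a
      exact ⟨mem_posToks_orOr.2 ⟨hdis, Or.inl ⟨rfl, hV, h1⟩⟩,
        typedEdge_empty.2 ⟨⟨subset_rfl, subset_rfl⟩, Or.inl ⟨rfl, Or.inl ⟨rfl, rfl⟩⟩⟩⟩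
    · -- diversion, case 1: `(x₁ ∪ (x₂ ∩ T), x₂ ∖ T)`, unit b
      obtain ⟨h2a, ⟨b, hb⟩, h2c⟩ := h2
      have hT2 : ∃ a, a ∈ x₂ ∧ a ∈ P ∩ Q := by
        by_contra hcon
        apply h2c
        intro a haT
        simp only [Set.mem_compl_iff, Set.mem_union, not_or]
        refine ⟨fun ha1 => h1 ⟨a, ha1, haT.2⟩, fun ha2 => hcon ⟨a, ha2, haT⟩⟩
      obtain ⟨a, ha2, haT⟩ := hT2
      have hu : (x₁ ∪ x₂ ∩ (P ∩ Q)) ∪ x₂ \ (P ∩ Q) = x₁ ∪ x₂ := by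
        ext c; simp only [Set.mem_union, Set.mem_inter_iff, Set.mem_sdiff]; tauto
      refine ⟨mem_posToks_orOr.2 ⟨?_, Or.inr (Or.inl ⟨rfl, ⟨b, Or.inl hb.2, hb.1.1⟩, ⟨a, Or.inr ⟨ha2, haT⟩, haT.2⟩⟩)⟩,
        typedEdge_empty.2 ⟨⟨Set.subset_union_left, Set.sdiff_subset⟩, Or.inl ⟨rfl, Or.inr ⟨rfl, by rw [hu]⟩⟩⟩⟩
      exact Set.disjoint_left.2 fun c hc hc' => hc.elim (fun h => hd c h hc'.1) fun h => hc'.2 h.2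
    · -- diversion, case 2: `(x₁ ∪ T, x₂)`, unit b
      obtain ⟨h3a, ⟨b, hb⟩, h3c⟩ := h3
      obtain ⟨a, ha⟩ := hW
      have haT : a ∈ P ∩ Q := by rw [← h3c]; exact ha
      have hTx3 : ∀ c, c ∈ P ∩ Q → c ∈ (x₁ ∪ x₂)ᶜ := fun c hc => by
        have : c ∈ (x₁ ∪ x₂)ᶜ ∩ Q := by rw [h3c]; exact hc
        exact this.1
      refine ⟨mem_posToks_orOr.2 ⟨?_, Or.inr (Or.inl ⟨rfl, ⟨b, Or.inl hb.2, hb.1.1⟩, ⟨a, Or.inr haT, haT.2⟩⟩)⟩,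
        typedEdge_empty.2 ⟨⟨Set.subset_union_left, subset_rfl⟩, Or.inl ⟨rfl, Or.inr ⟨rfl, ?_⟩⟩⟩⟩
      · refine Set.disjoint_left.2 fun c hc hc2 => hc.elim (fun h => hd c h hc2) fun h => ?_
        have := hTx3 c h
        simp only [Set.mem_compl_iff, Set.mem_union, not_or] at this
        exact this.2 hc2
      · intro c hc
        simp only [Set.mem_compl_iff, Set.mem_union, not_or] at hc ⊢
        exact ⟨hc.1.1, hc.2⟩
    · -- canonical landing: `(x₁ ∪ (x₃ ∩ Q), x₂)`, unit a
      obtain ⟨a, ha⟩ := hW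
      obtain ⟨b, hb⟩ := hV
      refine ⟨mem_posToks_orOr.2 ⟨?_, Or.inl ⟨rfl, ⟨b, Or.inl hb.1, hb.2⟩, ⟨a, Or.inr ha, ha.2⟩⟩⟩,
        typedEdge_empty.2 ⟨⟨Set.subset_union_left, subset_rfl⟩, Or.inl ⟨rfl, Or.inl ⟨rfl, rfl⟩⟩⟩⟩
      refine Set.disjoint_left.2 fun c hc hc2 => hc.elim (fun h => hd c h hc2) fun h => ?_
      have := h.1
      simp only [Set.mem_compl_iff, Set.mem_union, not_or] at this
      exact this.2 hc2
  · -- N2 tokens: `x₁ ∈ W`, `x₂ ∈ V`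
    simp only [ororMap, fin10, if_false, if_true]
    split_ifs with h1
    · exact ⟨mem_posToks_orOr.2 ⟨hdis, Or.inr (Or.inl ⟨rfl, h1, hW1⟩)⟩,
        typedEdge_empty.2 ⟨⟨subset_rfl, subset_rfl⟩, Or.inr (Or.inl ⟨rfl, rfl, rfl⟩)⟩⟩
    · obtain ⟨b, hb⟩ := hV2
      obtain ⟨a, ha⟩ := hW1
      have hu : (x₁ ∪ x₂ ∩ P) ∪ x₂ \ P = x₁ ∪ x₂ := by
        ext c; simp only [Set.mem_union, Set.mem_inter_iff, Set.mem_sdiff]; tauto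
      refine ⟨mem_posToks_orOr.2 ⟨?_, Or.inr (Or.inl ⟨rfl, ⟨b, Or.inr hb, hb.2⟩, ⟨a, Or.inl ha.1, ha.2⟩⟩)⟩,
        typedEdge_empty.2 ⟨⟨Set.subset_union_left, Set.sdiff_subset⟩, Or.inr (Or.inl ⟨rfl, rfl, by rw [hu]⟩)⟩⟩
      exact Set.disjoint_left.2 fun c hc hc' => hc.elim (fun h => hd c h hc'.1) fun h => hc'.2 h.2
  · -- N3 tokens: `x₂ ∈ V ∩ W`
    simp only [ororMap, fin20, fin21, if_false]
    split_ifs with h1 h2 h3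
    · -- `x₃ ∈ W`: own `T₂`
      exact ⟨mem_posToks_orOr.2 ⟨hdis, Or.inr (Or.inr ⟨rfl, hP2, h1⟩)⟩,
        typedEdge_empty.2 ⟨⟨subset_rfl, subset_rfl⟩, Or.inr (Or.inr ⟨rfl, Or.inr ⟨rfl, rfl⟩⟩)⟩⟩
    · -- exit to the mirror `T₂` token `(x₁, x₂ ∖ Q)`
      obtain ⟨⟨b, hb⟩, _⟩ := h2
      obtain ⟨a, ha⟩ := hQ2
      refine ⟨mem_posToks_orOr.2 ⟨?_, Or.inr (Or.inr ⟨rfl, ⟨b, ⟨hb.1, hb.2.2⟩, hb.2.1⟩, ⟨a, ?_, ha.2⟩⟩)⟩,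
        typedEdge_empty.2 ⟨⟨subset_rfl, Set.sdiff_subset⟩, Or.inr (Or.inr ⟨rfl, Or.inr ⟨rfl, rfl⟩⟩)⟩⟩
      · exact Set.disjoint_left.2 fun c hc hc' => hd c hc hc'.1
      · simp only [Set.mem_compl_iff, Set.mem_union, Set.mem_sdiff, not_or, not_and, not_not]
        exact ⟨fun h => hd a h ha.1, fun _ => ha.2⟩
    · -- shift: `(x₁ ∪ T, x₂ ∖ T)`, unit a
      obtain ⟨hTsub, hrest⟩ := h3
      have hT : ∃ a, a ∈ P ∩ Q := by
        rcases hrest with ⟨hL, _⟩ | ⟨_, _, hQT⟩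
        · obtain ⟨a, ha⟩ := hP2
          by_cases haQ : a ∈ Q
          · exact ⟨a, ha.2, haQ⟩
          · exact absurd ⟨a, ha.1, ha.2, haQ⟩ hL
        · obtain ⟨a, ha⟩ := hQ2
          exact ⟨a, by rw [← hQT]; exact ha⟩
      obtain ⟨a, ha⟩ := hT
      have hu : (x₁ ∪ P ∩ Q) ∪ x₂ \ (P ∩ Q) = x₁ ∪ x₂ := by
        ext c; simp only [Set.mem_union, Set.mem_inter_iff, Set.mem_sdiff]
        constructor
        · rintro ((h | h) | h)
          · exact Or.inl h
          · exact Or.inr (hTsub h)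
          · exact Or.inr h.1
        · rintro (h | h)
          · exact Or.inl (Or.inl h)
          · by_cases hc : c ∈ P ∧ c ∈ Q
            · exact Or.inl (Or.inr hc)
            · exact Or.inr ⟨h, hc⟩
      refine ⟨mem_posToks_orOr.2 ⟨?_, Or.inl ⟨rfl, ⟨a, Or.inr ha, ha.1⟩, ⟨a, Or.inr ha, ha.2⟩⟩⟩,
        typedEdge_empty.2 ⟨⟨Set.subset_union_left, Set.sdiff_subset⟩, Or.inr (Or.inr ⟨rfl, Or.inl ⟨rfl, by rw [hu]⟩⟩)⟩⟩
      exact Set.disjoint_left.2 fun c hc hc' => hc.elim (fun h => hd c h hc'.1) fun h => hc'.2 h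
    · -- own unit a: show `x₁ ∈ V ∩ W`
      have hQsub : ∀ a, a ∈ Q → a ∈ x₁ ∨ a ∈ x₂ := fun a haQ => by
        by_contra hcon
        exact h1 ⟨a, by simp only [Set.mem_compl_iff, Set.mem_union]; exact hcon, haQ⟩
      have key : (x₁ ∩ P).Nonempty ∧ (x₁ ∩ Q).Nonempty := by
        by_cases hTx2 : P ∩ Q ⊆ x₂
        · by_cases hL : (x₂ ∩ (P \ Q)).Nonempty
          · -- then the exit condition holds: contradiction
            exfalso
            have hA1 : ¬ (P \ Q ∩ x₁).Nonempty := fun hA1 => h2 ⟨hL, Or.inl hA1⟩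
            have hQT : x₂ ∩ Q = P ∩ Q := by
              by_contra hne
              exact h2 ⟨hL, Or.inr ⟨hTx2, hne⟩⟩
            exact h3 ⟨hTx2, Or.inr ⟨hL, Set.not_nonempty_iff_eq_empty.1 hA1, hQT⟩⟩
          · have hA1 : (P \ Q ∩ x₁).Nonempty := by
              by_contra hA1
              exact h3 ⟨hTx2, Or.inl ⟨hL, Or.inl (Set.not_nonempty_iff_eq_empty.1 hA1)⟩⟩
            have hQx2 : ¬ Q ⊆ x₂ := fun hQx2 => h3 ⟨hTx2, Or.inl ⟨hL, Or.inr hQx2⟩⟩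
            obtain ⟨b, hb⟩ := hA1
            obtain ⟨a, haQ, hax2⟩ := Set.not_subset.1 hQx2
            exact ⟨⟨b, hb.2, hb.1.1⟩, ⟨a, (hQsub a haQ).resolve_right hax2, haQ⟩⟩
        · obtain ⟨a, haT, hax2⟩ := Set.not_subset.1 hTx2
          have hax1 : a ∈ x₁ := (hQsub a haT.2).resolve_right hax2
          exact ⟨⟨a, hax1, haT.1⟩, ⟨a, hax1, haT.2⟩⟩
      exact ⟨mem_posToks_orOr.2 ⟨hdis, Or.inl ⟨rfl, key.1, key.2⟩⟩,
        typedEdge_empty.2 ⟨⟨subset_rfl, subset_rfl⟩, Or.inr (Or.inr ⟨rfl, Or.inl ⟨rfl, rfl⟩⟩)⟩⟩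

end Summit.CriticalPhenomena.PercolationContinuityZ3.Theorems.ThreePartition

end
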